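import Summits.CriticalPhenomena.SAWScalingLimit.Theorems.SAWRenewalTightnessTubeLowerBoundKestenTilt
import Summits.CriticalPhenomena.SAWScalingLimit.Theorems.SAWRenewalTightnessTubeLowerBoundSpanFloorOfBPD

/-!
# Sub-goal `breakPointDensity_of_spanHyperscaling` of the line `subcritical-renewal-floor`
(crux `TubeLowerBound`, stmt-CriticalPhenomena-4730), part I: break points of concatenated bridges,
sums over words

Word model of `SAWWords.lean` / `SAWWordBridges.lean`.  Kesten's factorisation of a bridge word
into irreducible bridges is unique (`SAW.eq_of_append_eq`); here we record the bookkeeping of BREAK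
POINTS (`SAW.IsBreak`) under concatenation that the moment computation of part II and the
break-point-density argument of part III need:

* `isBreak_of_append_left/right`, `isBreak_append_left/right/length` — the break points of a
  concatenation `u ++ v` of two non-empty bridges are exactly the break points of `u`, the junction
  `|u|`, and the shifted break points of `v`;
* `card_breaks_append` — hence `#breaks(u ++ v) = #breaks(u) + #breaks(v) + 1`, so that the
  self-avoiding bridge words with exactly `b` break points ("`b + 1` irreducible pieces", the class
  written out as `IsSAW w ∧ IsBridgeW w ∧ w ≠ [] ∧ #breaks(w) = b` below) are, for `b + 1`, exactly
  the concatenations `s ++ t` with `s` irreducible and `t` in the class `b`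
  (`exists_append_of_breaks_succ`, `breaks_append`);
* `exists_cut` — a bridge word of span `≥ D` splits at its first break point at level `≥ D` (if any)
  into a head all of whose break points lie below `D` (and of span `≥ D`) and a bridge tail;
* `straight` — the straight word `E^D` is a self-avoiding bridge word of span `D`;
* `tsum_words_eq_tsum_length`, `tsum_words_of_hasSum`, `tsum_irr_of_hasSum` — regrouping an
  `ℝ≥0∞`-valued sum over all step words by length, so that the `ℕ`-indexed real `HasSum`s of the
  stub's hypothesis become sums over words of the tilted weight `ω(w) = z^{|w|} e^{m·span(w)}` (always
  written out as `ENNReal.ofReal (z ^ w.length * Real.exp (m * (xEnd w : ℝ)))`, no definitions;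
  multiplicative, `twt_append`).

References: H. Kesten, *On the number of self-avoiding walks*, J. Math. Phys. 4 (1963), §4;
N. Madras, G. Slade, *The Self-Avoiding Walk* (1993), §4.2, (4.2.1), Definition 4.2.1.
-/

noncomputable section

namespace Summit.CriticalPhenomena.SAWScalingLimit.Theorems.TubeLowerBound.SubcriticalRenewalFloor

open scoped BigOperators Classical ENNReal
open Literature.Probability.LatticeModels
open Literature.Probability.RandomPlanarGeometry Literature.Probability.RandomPlanarGeometry.SAW

namespace BPD

open Finset

/-! ### Break points of a concatenation of bridges -/

/-- Restriction: a break point of `u ++ v` before `|u|` is a break point of `u`.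
[cite: Kesten1963SAW, §4] -/
theorem isBreak_of_append_left {u v : List Step} {j : ℕ} (hj : j < u.length)
    (h : IsBreak (u ++ v) j) : IsBreak u j := by
  obtain ⟨h0, -, hle, hgt⟩ := h
  refine ⟨h0, hj, fun i hi => ?_, fun i hi1 hi2 => ?_⟩
  · have := hle i hi
    rwa [xAt_append_left u v (hi.trans hj.le), xAt_append_left u v hj.le] at this
  · have := hgt i hi1 (by rw [List.length_append]; omega)
    rwa [xAt_append_left u v hj.le, xAt_append_left u v hi2] at this

/-- Restriction: a break point of `u ++ v` after `|u|` is (shifted) a break point of `v`.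
[cite: Kesten1963SAW, §4] -/
theorem isBreak_of_append_right {u v : List Step} {j : ℕ} (hj : 0 < j)
    (h : IsBreak (u ++ v) (u.length + j)) : IsBreak v j := by
  obtain ⟨-, hjl, hle, hgt⟩ := h
  rw [List.length_append] at hjl
  refine ⟨hj, by omega, fun i hi => ?_, fun i hi1 hi2 => ?_⟩
  · have := hle (u.length + i) (by omega)
    rw [xAt_append_right, xAt_append_right] at this
    linarith
  · have := hgt (u.length + i) (by omega) (by rw [List.length_append]; omega)
    rw [xAt_append_right, xAt_append_right] at this
    linarith

/-- Extension: a break point of a bridge `u` is a break point of `u ++ v` for every bridge `v`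
(the points of `v` lie strictly to the right of `u`). [cite: Kesten1963SAW, §4] -/
theorem isBreak_append_left {u v : List Step} (hu : IsBridgeW u) (hv : IsBridgeW v) {j : ℕ}
    (h : IsBreak u j) : IsBreak (u ++ v) j := by
  obtain ⟨h0, hjl, hle, hgt⟩ := h
  refine ⟨h0, by rw [List.length_append]; omega, fun i hi => ?_, fun i hi1 hi2 => ?_⟩
  · rw [xAt_append_left u v (hi.trans hjl.le), xAt_append_left u v hjl.le]
    exact hle i hi
  · rw [xAt_append_left u v hjl.le]
    rcases le_or_gt i u.length with hiu | hiu
    · rw [xAt_append_left u v hiu]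
      exact hgt i hi1 hiu
    · obtain ⟨k, rfl⟩ : ∃ k, i = u.length + k := ⟨i - u.length, by omega⟩
      rw [List.length_append] at hi2
      rw [xAt_append_right]
      have h1 := hu.xAt_le j
      have h2 := ((isBridgeW_iff v).1 hv k (by omega) (by omega)).1
      linarith

/-- Extension: a break point of a bridge `v`, shifted by `|u|`, is a break point of `u ++ v` for
every bridge `u`. [cite: Kesten1963SAW, §4] -/
theorem isBreak_append_right {u v : List Step} (hu : IsBridgeW u) (hv : IsBridgeW v) {j : ℕ}
    (h : IsBreak v j) : IsBreak (u ++ v) (u.length + j) := by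
  obtain ⟨h0, hjl, hle, hgt⟩ := h
  refine ⟨by omega, by rw [List.length_append]; omega, fun i hi => ?_, fun i hi1 hi2 => ?_⟩
  · rw [xAt_append_right]
    rcases le_or_gt i u.length with hiu | hiu
    · rw [xAt_append_left u v hiu]
      have h1 := hu.xAt_le i
      have h2 := ((isBridgeW_iff v).1 hv j h0 hjl.le).1
      linarith
    · obtain ⟨k, rfl⟩ : ∃ k, i = u.length + k := ⟨i - u.length, by omega⟩
      rw [xAt_append_right]
      have := hle k (by omega)
      linarith
  · obtain ⟨k, rfl⟩ : ∃ k, i = u.length + k := ⟨i - u.length, by omega⟩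
    rw [List.length_append] at hi2
    rw [xAt_append_right, xAt_append_right]
    have := hgt k (by omega) (by omega)
    linarith

/-- The junction of two non-empty bridges is a break point of their concatenation.
[cite: Kesten1963SAW, §4] -/
theorem isBreak_append_length {u v : List Step} (hu : IsBridgeW u) (hune : u ≠ []) (hvne : v ≠ [])
    (hv : IsBridgeW v) : IsBreak (u ++ v) u.length :=
  isBreak_length_of_prefix (t' := []) hu hune hvne (by rwa [List.append_nil])

/-- **Break count of a concatenation**: for non-empty bridges `u`, `v`,
`#breaks(u ++ v) = #breaks(u) + #breaks(v) + 1`. [cite: Kesten1963SAW, §4] -/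
theorem card_breaks_append {u v : List Step} (hu : IsBridgeW u) (hv : IsBridgeW v) (hune : u ≠ [])
    (hvne : v ≠ []) :
    ((Finset.range (u ++ v).length).filter (fun j => IsBreak (u ++ v) j)).card =
      ((Finset.range u.length).filter (fun j => IsBreak u j)).card +
        ((Finset.range v.length).filter (fun j => IsBreak v j)).card + 1 := by
  set S := (Finset.range (u ++ v).length).filter (fun j => IsBreak (u ++ v) j) with hS
  rw [← Finset.card_filter_add_card_filter_not (s := S) (fun j => j < u.length)]
  have h1 : S.filter (fun j => j < u.length) =
      (Finset.range u.length).filter (fun j => IsBreak u j) := by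
    ext j
    simp only [hS, Finset.mem_filter, Finset.mem_range, List.length_append]
    constructor
    · rintro ⟨⟨-, hb⟩, hj⟩
      exact ⟨hj, isBreak_of_append_left hj hb⟩
    · rintro ⟨hj, hb⟩
      exact ⟨⟨by omega, isBreak_append_left hu hv hb⟩, hj⟩
  have h2 : S.filter (fun j => ¬ j < u.length) =
      (insert 0 ((Finset.range v.length).filter (fun j => IsBreak v j))).map
        (addLeftEmbedding u.length) := by
    ext j
    simp only [hS, Finset.mem_filter, Finset.mem_range, List.length_append, Finset.mem_map,
      Finset.mem_insert, addLeftEmbedding_apply]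
    constructor
    · rintro ⟨⟨-, hb⟩, hj⟩
      obtain ⟨k, rfl⟩ : ∃ k, j = u.length + k := ⟨j - u.length, by omega⟩
      refine ⟨k, ?_, rfl⟩
      rcases Nat.eq_zero_or_pos k with hk | hk
      · exact Or.inl hk
      · have hb' := isBreak_of_append_right hk hb
        exact Or.inr ⟨hb'.2.1, hb'⟩
    · rintro ⟨k, hk, rfl⟩
      rcases hk with rfl | ⟨hk, hb⟩
      · have hlen := List.length_pos_iff.2 hvne
        refine ⟨⟨by omega, ?_⟩, by omega⟩
        rw [Nat.add_zero]
        exact isBreak_append_length hu hune hvne hv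
      · exact ⟨⟨by omega, isBreak_append_right hu hv hb⟩, by omega⟩
  have h0 : (0 : ℕ) ∉ (Finset.range v.length).filter (fun j => IsBreak v j) := by
    simp only [Finset.mem_filter, Finset.mem_range, not_and]
    intro _ h
    exact lt_irrefl 0 h.1
  rw [h1, h2, Finset.card_map, Finset.card_insert_of_notMem h0, add_assoc]

/-- An irreducible word has no break points. [cite: MadrasSlade1993, Definition 4.2.1] -/
theorem card_breaks_eq_zero {w : List Step} (h : IsIrreducible w) :
    ((Finset.range w.length).filter (fun j => IsBreak w j)).card = 0 := by
  rw [Finset.card_eq_zero, Finset.filter_eq_empty_iff]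
  exact fun j _ => h j

/-! ### The classes "exactly `b` break points" -/

/-- The class `b = 0` is the irreducible bridges. [cite: MadrasSlade1993, Definition 4.2.1] -/
theorem breaks_zero_iff {w : List Step} :
    (IsSAW w ∧ IsBridgeW w ∧ w ≠ [] ∧
      ((Finset.range w.length).filter (fun j => IsBreak w j)).card = 0) ↔ IsIrrBridge w := by
  constructor
  · rintro ⟨hs, hb, hne, h0⟩
    refine ⟨hs, hb, fun j hj => ?_, hne⟩
    rw [Finset.card_eq_zero, Finset.filter_eq_empty_iff] at h0
    exact h0 (Finset.mem_range.2 hj.2.1) hj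
  · intro h
    exact ⟨h.saw, h.bridge, h.ne_nil, card_breaks_eq_zero h.irr⟩

/-- Concatenation adds the classes (plus one junction). [cite: Kesten1963SAW, §4] -/
theorem breaks_append {u v : List Step} {a b : ℕ}
    (hu : IsSAW u ∧ IsBridgeW u ∧ u ≠ [] ∧
      ((Finset.range u.length).filter (fun j => IsBreak u j)).card = a)
    (hv : IsSAW v ∧ IsBridgeW v ∧ v ≠ [] ∧
      ((Finset.range v.length).filter (fun j => IsBreak v j)).card = b) :
    IsSAW (u ++ v) ∧ IsBridgeW (u ++ v) ∧ u ++ v ≠ [] ∧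
      ((Finset.range (u ++ v).length).filter (fun j => IsBreak (u ++ v) j)).card = a + b + 1 := by
  obtain ⟨hsu, hbu, hneu, hau⟩ := hu
  obtain ⟨hsv, hbv, hnev, hbv'⟩ := hv
  refine ⟨hsu.append_of_bridge hsv hbu hbv, hbu.append hbv, by simp [hneu], ?_⟩
  rw [card_breaks_append hbu hbv hneu hnev, hau, hbv']

/-- **First factor.** A word of the class `b + 1` is `s ++ t` with `s` an irreducible bridge and `t`
of the class `b` (`StripMass.exists_irrBridge_append` and the break count).
[cite: MadrasSlade1993, §4.2, (4.2.1)–(4.2.2)] -/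
theorem exists_append_of_breaks_succ {w : List Step} {b : ℕ}
    (hw : IsSAW w ∧ IsBridgeW w ∧ w ≠ [] ∧
      ((Finset.range w.length).filter (fun j => IsBreak w j)).card = b + 1) :
    ∃ s t : List Step, s ++ t = w ∧ IsIrrBridge s ∧
      (IsSAW t ∧ IsBridgeW t ∧ t ≠ [] ∧
        ((Finset.range t.length).filter (fun j => IsBreak t j)).card = b) := by
  obtain ⟨hs, hb, hne, hcount⟩ := hw
  obtain ⟨s, t, rfl, hsirr, ht⟩ := StripMass.exists_irrBridge_append hs hb hne
  have hst : IsSAW t := by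
    have := hs.drop s.length
    rwa [List.drop_left] at this
  have htne : t ≠ [] := by
    rintro rfl
    rw [List.append_nil, card_breaks_eq_zero hsirr.irr] at hcount
    omega
  refine ⟨s, t, rfl, hsirr, hst, ht, htne, ?_⟩
  have := card_breaks_append hsirr.bridge ht hsirr.ne_nil htne
  rw [card_breaks_eq_zero hsirr.irr] at this
  omega

/-! ### Cutting at the first break point at level `≥ D` -/

/-- **Cut at the first break point at level `≥ D`.** A non-empty self-avoiding bridge word of span
`≥ D` is `w' ++ v` where `w'` is a self-avoiding bridge word of span `≥ D` all of whose break points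
lie at levels `< D`, and either `v = []` (no break point of `w` reaches level `D`) or `v` is a
non-empty self-avoiding bridge word with `#breaks(w') + #breaks(v) + 1 = #breaks(w)`.
[cite: Kesten1963SAW, §4] -/
theorem exists_cut {w : List Step} (hs : IsSAW w) (hb : IsBridgeW w) (hne : w ≠ []) {D : ℤ}
    (hD : D ≤ xEnd w) :
    ∃ w' v : List Step, w' ++ v = w ∧ IsSAW w' ∧ IsBridgeW w' ∧ w' ≠ [] ∧ D ≤ xEnd w' ∧
      (∀ j, IsBreak w' j → xAt w' j < D) ∧
      (v = [] ∨ (IsSAW v ∧ IsBridgeW v ∧ v ≠ [] ∧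
        ((Finset.range w'.length).filter (fun j => IsBreak w' j)).card +
          ((Finset.range v.length).filter (fun j => IsBreak v j)).card + 1 =
            ((Finset.range w.length).filter (fun j => IsBreak w j)).card)) := by
  by_cases h : ∃ j, IsBreak w j ∧ D ≤ xAt w j
  · obtain ⟨hjb, hjD⟩ : IsBreak w (Nat.find h) ∧ D ≤ xAt w (Nat.find h) := Nat.find_spec h
    set j := Nat.find h with hj
    have hmin : ∀ i, i < j → ¬ (IsBreak w i ∧ D ≤ xAt w i) := fun i hi => Nat.find_min h hi
    have hjl : j < w.length := hjb.2.1
    have hl : (w.take j).length = j := by simp [min_eq_left hjl.le]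
    have htb := KestenIdentity.isBridgeW_take_of_isBreak hb hjb
    have hdb := KestenIdentity.isBridgeW_drop_of_isBreak hb hjb
    have htne : w.take j ≠ [] := by
      rw [ne_eq, ← List.length_eq_zero_iff, hl]
      exact hjb.1.ne'
    have hdne : w.drop j ≠ [] := by
      rw [ne_eq, ← List.length_eq_zero_iff, List.length_drop]
      omega
    refine ⟨w.take j, w.drop j, List.take_append_drop j w, hs.take j, htb, htne, ?_, ?_,
      Or.inr ⟨hs.drop j, hdb, hdne, ?_⟩⟩
    · rw [xEnd, hl, KestenIdentity.xAt_take w hjl.le le_rfl]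
      exact hjD
    · intro i hi
      have hil : i < j := by
        have := hi.2.1
        rwa [hl] at this
      have hi' : IsBreak w i := by
        have := isBreak_append_left htb hdb hi
        rwa [List.take_append_drop] at this
      rw [KestenIdentity.xAt_take w hjl.le hil.le]
      by_contra hge
      push Not at hge
      exact hmin i hil ⟨hi', hge⟩
    · have := card_breaks_append htb hdb htne hdne
      rw [List.take_append_drop] at this
      exact this.symm
  · push Not at h
    exact ⟨w, [], List.append_nil w, hs, hb, hne, hD, h, Or.inl rfl⟩

/-! ### The straight word -/

/-- The straight word `E^D = [+e₀, …, +e₀]` is a self-avoiding bridge word of span `D`. [folklore] -/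
theorem straight (D : ℕ) :
    IsSAW (List.replicate D (0 : Step)) ∧ IsBridgeW (List.replicate D (0 : Step)) ∧
      xEnd (List.replicate D (0 : Step)) = (D : ℤ) := by
  induction D with
  | zero => exact ⟨isSAW_nil, isBridgeW_nil, by simp [xEnd]⟩
  | succ D ih =>
    obtain ⟨hs, hb, hx⟩ := ih
    have e : List.replicate (D + 1) (0 : Step) = [(0 : Step)] ++ List.replicate D (0 : Step) := by
      rw [List.replicate_succ]
      rfl
    have hx1 : xEnd [(0 : Step)] = 1 := by decide
    rw [e]
    refine ⟨Renewal.isIrrBridge_single.saw.append_of_bridge hs Renewal.isIrrBridge_single.bridge hb,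
      Renewal.isIrrBridge_single.bridge.append hb, ?_⟩
    rw [xEnd_append, hx, hx1]
    push_cast
    ring

/-- The straight word `E^D` (`D ≥ 1`) belongs to the break-point-density family at scale `D`:
span `D ∈ [D, 2D)` and every break point `j < D` lies at level `x(j) ≤ j < D`. [folklore] -/
theorem straight_mem {D : ℕ} (hD : 1 ≤ D) :
    List.replicate D (0 : Step) ∈ (sawWords D).filter (fun w => IsBridgeW w ∧ (D : ℤ) ≤ xEnd w ∧
      xEnd w < 2 * (D : ℤ) ∧ ∀ j, IsBreak w j → xAt w j < (D : ℤ)) := by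
  obtain ⟨hs, hb, hx⟩ := straight D
  refine Finset.mem_filter.2 ⟨mem_sawWords.2 ⟨List.length_replicate, hs⟩, hb, by rw [hx],
    by rw [hx]; omega, fun j hj => ?_⟩
  have h1 := hj.2.1
  rw [List.length_replicate] at h1
  have h2 := KestenTilt.xAt_le_nat (List.replicate D (0 : Step)) j
  omega

/-! ### Regrouping sums over words -/

/-- A sum over all step words is the sum over the lengths of the finite sums over `words n`.
[folklore] -/
theorem tsum_words_eq_tsum_length (G : List Step → ℝ≥0∞) :
    ∑' w, G w = ∑' n : ℕ, ∑ w ∈ words n, G w := by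
  rw [← ENNReal.tsum_fiberwise G List.length]
  refine tsum_congr fun n => ?_
  have h : List.length ⁻¹' {n} = ((words n : Finset (List Step)) : Set (List Step)) := by
    ext w
    simp [mem_words]
  rw [tsum_congr_set_coe G h, Finset.tsum_subtype']

/-- From an `ℕ`-indexed `HasSum` of the (non-negative) finite sums over `(sawWords n).filter P` to
the `ℝ≥0∞`-valued sum over all words. [folklore] -/
theorem tsum_words_of_hasSum {P : List Step → Prop} {F : List Step → ℝ} {S : ℝ}
    (hF : ∀ w, IsSAW w → P w → 0 ≤ F w)
    (h : HasSum (fun n : ℕ => ∑ w ∈ (sawWords n).filter (fun w => P w), F w) S) :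
    ∑' w, (if IsSAW w ∧ P w then ENNReal.ofReal (F w) else 0) = ENNReal.ofReal S := by
  rw [tsum_words_eq_tsum_length]
  have hnn : ∀ n, 0 ≤ ∑ w ∈ (sawWords n).filter (fun w => P w), F w := fun n =>
    Finset.sum_nonneg fun w hw => by
      obtain ⟨h1, h2⟩ := Finset.mem_filter.1 hw
      exact hF w (mem_sawWords.1 h1).2 h2
  rw [← h.tsum_eq, ENNReal.ofReal_tsum_of_nonneg hnn h.summable]
  refine tsum_congr fun n => ?_
  rw [ENNReal.ofReal_sum_of_nonneg (fun w hw => ?_)]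
  · rw [sawWords, Finset.filter_filter, Finset.sum_filter]
  · obtain ⟨h1, h2⟩ := Finset.mem_filter.1 hw
    exact hF w (mem_sawWords.1 h1).2 h2

/-- The hypothesis' tilted functionals over irreducible bridges as sums over words: if
`Σ_n Σ_{w ∈ sawWords n, irreducible} F(w) z^{|w|} e^{m·span(w)} = S` (`F ≥ 0`) then
`Σ_{w irreducible} F(w) ω(w) = S` in `ℝ≥0∞`. [folklore] -/
theorem tsum_irr_of_hasSum {z m : ℝ} (hz : 0 ≤ z) {F : List Step → ℝ}
    (hF : ∀ w, IsIrrBridge w → 0 ≤ F w) {S : ℝ}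
    (h : HasSum (fun n : ℕ => ∑ w ∈ (sawWords n).filter (fun w => IsIrrBridge w),
      F w * (z ^ w.length * Real.exp (m * (xEnd w : ℝ)))) S) :
    ∑' w, (if IsIrrBridge w then ENNReal.ofReal (F w) * ENNReal.ofReal (z ^ w.length * Real.exp (m * (xEnd w : ℝ))) else 0) = ENNReal.ofReal S := by
  rw [← tsum_words_of_hasSum (P := fun w => IsIrrBridge w)
    (fun w _ hw => mul_nonneg (hF w hw) (KestenTilt.tiltWt_nonneg hz m w)) h]
  refine tsum_congr fun w => ?_
  by_cases hw : IsIrrBridge w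
  · rw [if_pos hw, if_pos ⟨hw.saw, hw⟩, ENNReal.ofReal_mul (hF w hw)]
  · rw [if_neg hw, if_neg (fun h => hw h.2)]

/-! ### The tilted weight -/

/-- The tilted weight is multiplicative under concatenation. [folklore] -/
theorem twt_append {z : ℝ} (hz : 0 ≤ z) (m : ℝ) (u v : List Step) :
    ENNReal.ofReal (z ^ (u ++ v).length * Real.exp (m * (xEnd (u ++ v) : ℝ))) = ENNReal.ofReal (z ^ u.length * Real.exp (m * (xEnd u : ℝ))) * ENNReal.ofReal (z ^ v.length * Real.exp (m * (xEnd v : ℝ))) := by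
  rw [KestenTilt.tiltWt_append, ENNReal.ofReal_mul (KestenTilt.tiltWt_nonneg hz m u)]

/-- The empty word has weight one. [folklore] -/
theorem twt_nil (z m : ℝ) : ENNReal.ofReal (z ^ (([] : List Step)).length * Real.exp (m * (xEnd (([] : List Step)) : ℝ))) = 1 := by
  rw [KestenTilt.tiltWt_nil, ENNReal.ofReal_one]

/-- Spans of bridges add under concatenation (in `ℝ≥0∞`). [folklore] -/
theorem x_append {u v : List Step} (hu : IsBridgeW u) (hv : IsBridgeW v) :
    ENNReal.ofReal (xEnd (u ++ v) : ℝ) = ENNReal.ofReal (xEnd u : ℝ) + ENNReal.ofReal (xEnd v : ℝ) := by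
  have h1 : (0 : ℝ) ≤ (xEnd u : ℝ) := by exact_mod_cast hu.xEnd_nonneg
  have h2 : (0 : ℝ) ≤ (xEnd v : ℝ) := by exact_mod_cast hv.xEnd_nonneg
  rw [xEnd_append, Int.cast_add, ENNReal.ofReal_add h1 h2]

end BPD

/-! ### Registered sub-goal of part I -/

/-- **Break count of a concatenation** (the registered sub-goal `bpd_breaksAppend` of the crux item,
part I of the sub-goal `breakPointDensity_of_spanHyperscaling`; `BPD.card_breaks_append` in closed
form): for non-empty bridges `u`, `v`, `#breaks(u ++ v) = #breaks(u) + #breaks(v) + 1` — the break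
points of `u ++ v` are those of `u`, the junction `|u|`, and the shifted break points of `v`.
[cite: Kesten1963SAW, §4] -/
theorem bpd_breaksAppend :
    ∀ u v : List Step, IsBridgeW u → IsBridgeW v → u ≠ [] → v ≠ [] → ((Finset.range (u ++ v).length).filter (fun j => IsBreak (u ++ v) j)).card = ((Finset.range u.length).filter (fun j => IsBreak u j)).card + ((Finset.range v.length).filter (fun j => IsBreak v j)).card + 1 :=
  fun _ _ hu hv hune hvne => BPD.card_breaks_append hu hv hune hvne

end Summit.CriticalPhenomena.SAWScalingLimit.Theorems.TubeLowerBound.SubcriticalRenewalFloor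

end
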